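import Summits.NavierStokesRegularity.FluidComputer.BlockJunk
import Literature.Analysis.FluidPDE.FluidComputer.TypeOneNumber

/-!
# Fourier-block design, II: readout, design states, junk, regions — and the easy static axioms

HONEST FRAMING (cell `pub-fluidc`, verbatim): *low prior, high value-of-information experiment on
Tao's machine paradigm; NOT a claim that NS blows up.*

The CONCRETE reading of the READOUT / REGIONS groups of `ShadowedCircuit S O s`
(`CircuitArchitecture.lean`) for the simplest Fourier-block design over a dyadic spec sheet `S` with
`λ₀ = 1` (`λ_n = 2ⁿ`): one design mode per block, `ψ_k = ψ_{0,k}` — Tao's `L²`-normalised,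
divergence-free, frequency-localised wavelet of `CascadeWaveletData 1 1` (ε₀ = 1: Fourier support
in the thin shell `2ᵏ < |ξ| ≤ (3/2)·2ᵏ`, pairwise disjoint, orthonormal) — and

* observable space `O = ℝ × ℝ` (sup metric); `read n v = (Re⟨v,ψ_n⟩/√E_n, Re⟨v,ψ_{n+1}⟩/√E_{n+1})`
  (input amplitude of block `n`, output amplitude of block `n+1`, each in units of its own block's
  energy scale, so that generation `n+1` reads generation `n`'s output coordinate verbatim);
* design states `recon n (a,b) = a√E_n ψ_n + b√E_{n+1} ψ_{n+1}`;
* junk `junk n v = inf_p J_{μ,λ_n,s}(v − recon n p)`, the weighted seminorm of `BlockJunk` minimised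
  over design states (`X^s_{λ_n}`-Lipschitz, zero on design states, and — file `BlockHandoff` —
  forgetting the spent block at the rate `(3/4)^s` and all coarser content at the rate `2^{-s}`);
* regions `Acore = [aLo,aHi] × [−c0,c0]` (input loaded, output empty), `Ain` its open
  `δ`-neighbourhood, `Aout = [−σsp,σsp] × [aLo,aHi]` (input spent, output loaded), with the design
  inequalities collected in `Params S`.

Proved here (the fields of the same names): `read_lip` (`Λ = η^{-1/2}`), `read_recon`, `junk_recon`,
`junk_perturb`, `core_thick`, `floor_cert` (a state read in `Ain` has `|⟨v,ψ_n⟩|² > E_n`, and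
`ψ̂_n` lives in `|ξ| > 2ⁿ = λ_n`). No statement about the Navier–Stokes PDE is made here.
-/

noncomputable section

open MeasureTheory Set Filter Topology Metric
open scoped ENNReal NNReal SchwartzMap

namespace Summit.NavierStokesRegularity.FluidComputer

open Literature.Analysis.FluidPDE.Tao2016
open Literature.Analysis.FluidPDE.FluidComputer

namespace BlockDesign

/-! ### §1. Design parameters -/

/-- The design inequalities of the Fourier-block instance over the spec sheet `S` (`λ₀ = 1`):
junk order `s ≥ 0`, infrared floor `0 ≤ μ ≤ 1`, loaded amplitude range `[aLo, aHi]` with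
`aLo − δ ≥ 1` (floor certificate), output tolerance `c0`, spent tolerance `σsp`, thresholds
`0 ≤ jcore < jin ≤ jrun`, and the two hand-off budgets: `next_output` (the junk bound controls the
amplitude two blocks up, `4^{-s} jrun ≤ c0 η`) and `erasure` (discounted junk + discounted spent
input fit under the next core threshold, `((1/2)^s + (3/4)^s) jrun + (3/4)^s σsp ≤ jcore √η`). [folklore] -/
structure Params (S : CascadeSpecs) where
  /-- junk weight order -/
  s : ℝ
  /-- infrared floor frequency of the junk weight -/
  μ : ℝ
  /-- loaded input amplitude range `[aLo, aHi]` -/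
  aLo : ℝ
  aHi : ℝ
  /-- output-empty tolerance -/
  c0 : ℝ
  /-- core thickness -/
  δ : ℝ
  /-- spent-input tolerance -/
  σsp : ℝ
  /-- junk thresholds: core, loaded, running -/
  jcore : ℝ
  jin : ℝ
  jrun : ℝ
  lam0_eq : S.lam0 = 1
  s_nonneg : 0 ≤ s
  μ_nonneg : 0 ≤ μ
  μ_le_one : μ ≤ 1
  δ_pos : 0 < δ
  one_le : 1 ≤ aLo - δ
  aLo_le_aHi : aLo ≤ aHi
  c0_nonneg : 0 ≤ c0
  jcore_nonneg : 0 ≤ jcore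
  jcore_lt_jin : jcore < jin
  jin_le_jrun : jin ≤ jrun
  next_output : jrun ≤ c0 * S.eta * (4 : ℝ) ^ s
  erasure : ((1 / 2 : ℝ) ^ s + (3 / 4 : ℝ) ^ s) * jrun + (3 / 4 : ℝ) ^ s * σsp ≤
    jcore * Real.sqrt S.eta

namespace Params

variable {S : CascadeSpecs} (P : Params S)

/-- `λ_n = 2ⁿ`. [folklore] -/
theorem lam_eq (P : Params S) (n : ℕ) : S.lam n = (2 : ℝ) ^ n := by
  rw [CascadeSpecs.lam, P.lam0_eq, one_mul]

/-- `0 < jrun`. [folklore] -/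
theorem jrun_pos : 0 < P.jrun :=
  lt_of_lt_of_le (lt_of_le_of_lt P.jcore_nonneg P.jcore_lt_jin) P.jin_le_jrun

/-- `1 ≤ aLo`. [folklore] -/
theorem one_le_aLo : 1 ≤ P.aLo := by linarith [P.one_le, P.δ_pos]

end Params

/-! ### §2. Spec-sheet arithmetic -/

section Spec

variable (S : CascadeSpecs)

/-- `√E_{n+1} = √η √E_n` (from `CascadeSpecs.Emin_succ` of `TypeOneNumber`). [folklore] -/
theorem sqrt_Emin_succ (n : ℕ) :
    Real.sqrt (S.Emin (n + 1)) = Real.sqrt S.eta * Real.sqrt (S.Emin n) := by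
  rw [S.Emin_succ, Real.sqrt_mul S.eta_pos.le]

/-- `√E_{n+2} = η √E_n`. [folklore] -/
theorem sqrt_Emin_succ_succ (n : ℕ) :
    Real.sqrt (S.Emin (n + 2)) = S.eta * Real.sqrt (S.Emin n) := by
  rw [show n + 2 = n + 1 + 1 from rfl, sqrt_Emin_succ, sqrt_Emin_succ, ← mul_assoc,
    Real.mul_self_sqrt S.eta_pos.le]

/-- `√E_n > 0`. [folklore] -/
theorem sqrt_Emin_pos (n : ℕ) : 0 < Real.sqrt (S.Emin n) := Real.sqrt_pos.2 (S.Emin_pos n)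

end Spec

/-! ### §3. Design modes and coefficients -/

section Modes

variable (𝒟 : CascadeWaveletData 1 1)

/-- `0 < 1 + 1` in `ℝ` (the dilation factor `1 + ε₀` with `ε₀ = 1`). [folklore] -/
theorem two_pos' : (0 : ℝ) < 1 + 1 := by norm_num

/-- The design mode of block `k`: Tao's wavelet `ψ_{0,k}` at dyadic scale `2ᵏ` (ε₀ = 1). [cite: Tao2016AveragedNS, Def. 3.1] -/
def mode (k : ℕ) : L2C := cascadeWavelet 1 (𝒟.ψ 0) (k : ℤ)

/-- The block-`k` coefficient `⟨v, ψ_k⟩` of a state. [folklore] -/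
def coef (k : ℕ) (v : L2C) : ℂ := pairing v (mode 𝒟 k)

/-- `⟨v, ψ_k⟩` is the inner product with the (real) design mode. [folklore] -/
theorem coef_eq_inner (k : ℕ) (v : L2C) : coef 𝒟 k v = inner ℂ (mode 𝒟 k) v :=
  pairing_eq_inner (isReal_cascadeWavelet 1 (𝒟.ψ 0) k)

/-- `‖ψ_k‖ = 1`. [cite: Tao2016AveragedNS, §4 p. 21] -/
theorem norm_mode (k : ℕ) : ‖mode 𝒟 k‖ = 1 := 𝒟.norm_cascadeWavelet two_pos' 0 k

/-- Orthonormality: `⟨ψ_j, ψ_k⟩ = 1_{j=k}`. [cite: Tao2016AveragedNS, §4 Lemma 4.1] -/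
theorem coef_mode (k j : ℕ) : coef 𝒟 k (mode 𝒟 j) = if j = k then 1 else 0 := by
  unfold coef mode
  rw [𝒟.pairing_cascadeWavelet one_pos 0 0 (j : ℤ) (k : ℤ)]
  simp [Nat.cast_inj]

/-- The block coefficient is additive in the state. [folklore] -/
theorem coef_add (k : ℕ) (v w : L2C) : coef 𝒟 k (v + w) = coef 𝒟 k v + coef 𝒟 k w := by
  simp only [coef_eq_inner, inner_add_right]

/-- The block coefficient is `ℂ`-homogeneous in the state. [folklore] -/
theorem coef_smul (k : ℕ) (c : ℂ) (v : L2C) : coef 𝒟 k (c • v) = c * coef 𝒟 k v := by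
  simp only [coef_eq_inner, inner_smul_right]

/-- The block coefficient respects subtraction. [folklore] -/
theorem coef_sub (k : ℕ) (v w : L2C) : coef 𝒟 k (v - w) = coef 𝒟 k v - coef 𝒟 k w := by
  simp only [coef_eq_inner, inner_sub_right]

/-- `|⟨v, ψ_k⟩| ≤ ‖v‖`. [folklore] -/
theorem norm_coef_le (k : ℕ) (v : L2C) : ‖coef 𝒟 k v‖ ≤ ‖v‖ := by
  rw [coef_eq_inner]
  have h := norm_inner_le_norm (𝕜 := ℂ) (mode 𝒟 k) v
  rwa [norm_mode, one_mul] at h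

/-- The frequency region of block `k` lies in the thin dyadic shell `2ᵏ < |ξ| ≤ (3/2) 2ᵏ`. [cite: Tao2016AveragedNS, §4 Lemma 4.1] -/
theorem norm_of_mem_region (k : ℕ) {ξ : EuclideanSpace ℝ (Fin 3)} (h : ξ ∈ freqRegion 𝒟 0 (k : ℤ)) :
    (2 : ℝ) ^ k < ‖ξ‖ ∧ ‖ξ‖ ≤ (2 : ℝ) ^ k * (3 / 2) := by
  have h' := 𝒟.norm_of_mem_freqRegion two_pos' 0 (k : ℤ) h
  rw [one_add_one_eq_two, zpow_natCast] at h'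
  norm_num at h'
  exact h'

end Modes

/-! ### §4. Readout, design states, junk, regions -/

section Design

variable (𝒟 : CascadeWaveletData 1 1) (S : CascadeSpecs)

/-- READOUT: `read n v = (Re⟨v,ψ_n⟩/√E_n, Re⟨v,ψ_{n+1}⟩/√E_{n+1})`. [folklore] -/
def read (n : ℕ) (v : L2C) : ℝ × ℝ :=
  ((coef 𝒟 n v).re / Real.sqrt (S.Emin n), (coef 𝒟 (n + 1) v).re / Real.sqrt (S.Emin (n + 1)))

/-- DESIGN STATES: `recon n (a, b) = a√E_n ψ_n + b√E_{n+1} ψ_{n+1}`. [folklore] -/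
def recon (n : ℕ) (p : ℝ × ℝ) : L2C :=
  ((p.1 * Real.sqrt (S.Emin n) : ℝ) : ℂ) • mode 𝒟 n +
    ((p.2 * Real.sqrt (S.Emin (n + 1)) : ℝ) : ℂ) • mode 𝒟 (n + 1)

variable {S} (P : Params S)

/-- JUNK: the weighted distance `inf_p J_{μ,λ_n,s}(v − recon n p)` to the design states. [folklore] -/
def junk (n : ℕ) (v : L2C) : ℝ≥0∞ := ⨅ p : ℝ × ℝ, J P.μ (S.lam n) P.s (v - recon 𝒟 S n p)

/-- Loaded core: input amplitude in `[aLo, aHi]`, output amplitude `≤ c0`. [folklore] -/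
def Acore : Set (ℝ × ℝ) := Set.Icc P.aLo P.aHi ×ˢ Set.Icc (-P.c0) P.c0

/-- Admissible inputs: the open `δ`-neighbourhood of the core. [folklore] -/
def Ain : Set (ℝ × ℝ) := {q | ∃ p ∈ Acore P, dist q p < P.δ}

/-- Outputs: input amplitude spent (`≤ σsp`), output amplitude in `[aLo, aHi]`. [folklore] -/
def Aout : Set (ℝ × ℝ) := Set.Icc (-P.σsp) P.σsp ×ˢ Set.Icc P.aLo P.aHi

variable {𝒟 P}

/-- Coefficients of a design state: `⟨recon n (a,b), ψ_k⟩ = a√E_n 1_{k=n} + b√E_{n+1} 1_{k=n+1}`. [folklore] -/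
theorem coef_recon (n k : ℕ) (p : ℝ × ℝ) :
    coef 𝒟 k (recon 𝒟 S n p) =
      (if n = k then (((p.1 * Real.sqrt (S.Emin n) : ℝ) : ℂ)) else 0) +
        (if n + 1 = k then (((p.2 * Real.sqrt (S.Emin (n + 1)) : ℝ) : ℂ)) else 0) := by
  simp only [recon, coef_add, coef_smul, coef_mode, mul_ite, mul_one, mul_zero]

/-- `⟨recon n (a,b), ψ_n⟩ = a√E_n`. [folklore] -/
theorem coef_recon_self (n : ℕ) (p : ℝ × ℝ) :
    coef 𝒟 n (recon 𝒟 S n p) = ((p.1 * Real.sqrt (S.Emin n) : ℝ) : ℂ) := by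
  simp [coef_recon]

/-- `⟨recon n (a,b), ψ_{n+1}⟩ = b√E_{n+1}`. [folklore] -/
theorem coef_recon_succ (n : ℕ) (p : ℝ × ℝ) :
    coef 𝒟 (n + 1) (recon 𝒟 S n p) = ((p.2 * Real.sqrt (S.Emin (n + 1)) : ℝ) : ℂ) := by
  simp [coef_recon]

/-- `⟨recon n (a,b), ψ_{n+2}⟩ = 0`. [folklore] -/
theorem coef_recon_succ_succ (n : ℕ) (p : ℝ × ℝ) : coef 𝒟 (n + 2) (recon 𝒟 S n p) = 0 := by
  simp [coef_recon]

/-- `read_recon`: design states read as designed. [folklore] -/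
theorem read_recon (n : ℕ) (p : ℝ × ℝ) : read 𝒟 S n (recon 𝒟 S n p) = p := by
  rw [read, coef_recon_self, coef_recon_succ, Complex.ofReal_re, Complex.ofReal_re,
    mul_div_cancel_right₀ _ (sqrt_Emin_pos S n).ne',
    mul_div_cancel_right₀ _ (sqrt_Emin_pos S (n + 1)).ne']

/-- `read_lip` with `Λ = η^{-1/2}`: `dist (read n v) (read n w) √E_n ≤ η^{-1/2} ‖v − w‖`. [folklore] -/
theorem read_lip (n : ℕ) (v w : L2C) :
    dist (read 𝒟 S n v) (read 𝒟 S n w) * Real.sqrt (S.Emin n) ≤ (Real.sqrt S.eta)⁻¹ * ‖v - w‖ := by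
  have hE := sqrt_Emin_pos S n
  have hη : 0 < Real.sqrt S.eta := Real.sqrt_pos.2 S.eta_pos
  have hη1 : Real.sqrt S.eta ≤ 1 := Real.sqrt_le_one.mpr S.eta_le_one
  have key : ∀ k, |(coef 𝒟 k v).re - (coef 𝒟 k w).re| ≤ ‖v - w‖ := fun k => by
    rw [← Complex.sub_re, ← coef_sub]
    exact (Complex.abs_re_le_norm _).trans (norm_coef_le 𝒟 k _)
  have h1 : dist (read 𝒟 S n v).1 (read 𝒟 S n w).1 * Real.sqrt (S.Emin n) ≤ ‖v - w‖ := by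
    simp only [read, Real.dist_eq, ← sub_div, abs_div, abs_of_pos hE, div_mul_cancel₀ _ hE.ne']
    exact key n
  have h2 : dist (read 𝒟 S n v).2 (read 𝒟 S n w).2 * Real.sqrt (S.Emin n) ≤
      (Real.sqrt S.eta)⁻¹ * ‖v - w‖ := by
    have hE' := sqrt_Emin_pos S (n + 1)
    simp only [read, Real.dist_eq, ← sub_div, abs_div, abs_of_pos hE']
    rw [sqrt_Emin_succ, div_mul_eq_mul_div, mul_div_mul_right _ _ hE.ne', div_eq_inv_mul]
    exact mul_le_mul_of_nonneg_left (key (n + 1)) (inv_nonneg.2 hη.le)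
  rw [Prod.dist_eq, max_mul_of_nonneg _ _ hE.le]
  refine max_le (h1.trans ?_) h2
  exact le_mul_of_one_le_left (norm_nonneg _) ((one_le_inv₀ hη).2 hη1)

/-- The junk is below the weighted distance to any one design state. [folklore] -/
theorem junk_le (n : ℕ) (v : L2C) (p : ℝ × ℝ) :
    junk 𝒟 P n v ≤ J P.μ (S.lam n) P.s (v - recon 𝒟 S n p) := iInf_le _ p

/-- `junk_recon`: design states carry no junk. [folklore] -/
theorem junk_recon (n : ℕ) (p : ℝ × ℝ) : junk 𝒟 P n (recon 𝒟 S n p) = 0 :=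
  le_antisymm ((junk_le n _ p).trans (by rw [sub_self, J_zero])) (zero_le)

/-- `μ ≤ λ_n` (the infrared floor is below every machine scale). [folklore] -/
theorem μ_le_lam (n : ℕ) : P.μ ≤ S.lam n :=
  P.μ_le_one.trans (by rw [P.lam_eq]; exact one_le_pow₀ one_le_two)

/-- `junk_perturb`: the junk is `1`-Lipschitz in `X^s_{λ_n}`. [folklore] -/
theorem junk_perturb (n : ℕ) (v w : L2C) :
    junk 𝒟 P n w ≤ junk 𝒟 P n v + scaledSobolevNorm P.s (S.lam n) (w - v) := by
  unfold junk
  rw [ENNReal.iInf_add]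
  refine le_iInf fun p => (iInf_le _ p).trans ?_
  calc J P.μ (S.lam n) P.s (w - recon 𝒟 S n p)
      ≤ J P.μ (S.lam n) P.s (w - v) + J P.μ (S.lam n) P.s (v - recon 𝒟 S n p) :=
        J_sub_le _ _ _ _ _ _
    _ ≤ scaledSobolevNorm P.s (S.lam n) (w - v) + J P.μ (S.lam n) P.s (v - recon 𝒟 S n p) := by
        gcongr
        exact J_le_scaledSobolevNorm P.μ_nonneg (μ_le_lam n) P.s_nonneg _
    _ = _ := add_comm _ _

/-- `core_thick`: `ball(Acore, δ) ⊆ Ain`. [folklore] -/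
theorem core_thick (p : ℝ × ℝ) (hp : p ∈ Acore P) : Metric.ball p P.δ ⊆ Ain P :=
  fun q hq => ⟨p, hp, by rwa [Metric.mem_ball] at hq⟩

/-- A state read in `Ain` has input amplitude `> 1`. [folklore] -/
theorem one_lt_of_mem_Ain {q : ℝ × ℝ} (hq : q ∈ Ain P) : 1 < q.1 := by
  obtain ⟨p, hp, hd⟩ := hq
  have h1 : |q.1 - p.1| < P.δ :=
    lt_of_le_of_lt (by rw [← Real.dist_eq, Prod.dist_eq]; exact le_max_left _ _) hd
  have h2 : P.aLo ≤ p.1 := hp.1.1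
  linarith [(abs_lt.1 h1).1, P.one_le]

/-- The block coefficient is carried by the frequencies `|ξ| ≥ λ_n`:
`|⟨v, ψ_n⟩|² ≤ ∫_{|ξ| ≥ λ_n} |v̂|²`. [folklore] -/
theorem enorm_coef_sq_le_highFreqEnergy (n : ℕ) (v : L2C) :
    ‖coef 𝒟 n v‖ₑ ^ 2 ≤ highFreqEnergy ((2 : ℝ) ^ n) v := by
  set A : Set (EuclideanSpace ℝ (Fin 3)) := {ξ | (2 : ℝ) ^ n ≤ ‖ξ‖} with hA
  have hAm : MeasurableSet A := measurableSet_le measurable_const measurable_norm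
  set W : EuclideanSpace ℝ (Fin 3) → ℝ≥0∞ := A.indicator 1 with hW
  have hWm : Measurable W := measurable_one.indicator hAm
  have h1 : (1 : ℝ≥0∞) * ‖coef 𝒟 n v‖ₑ ≤
      (∫⁻ ξ, (W ξ * ‖fourierFn v ξ‖ₑ) ^ (2 : ℝ)) ^ (1 / 2 : ℝ) := by
    refine mul_enorm_pairing_le 𝒟 two_pos' 0 (n : ℤ) hWm ENNReal.one_ne_top (fun ξ hξ => ?_) v
    have hin : ξ ∈ A := by
      rw [hA, Set.mem_setOf_eq]
      exact (norm_of_mem_region 𝒟 n hξ).1.le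
    rw [hW, Set.indicator_of_mem hin, Pi.one_apply]
  have h2 : ∫⁻ ξ, (W ξ * ‖fourierFn v ξ‖ₑ) ^ (2 : ℝ) = highFreqEnergy ((2 : ℝ) ^ n) v := by
    rw [highFreqEnergy, ← lintegral_indicator hAm]
    refine lintegral_congr fun ξ => ?_
    by_cases hξ : ξ ∈ A
    · rw [hW, Set.indicator_of_mem hξ, Set.indicator_of_mem hξ, Pi.one_apply, one_mul,
        ENNReal.rpow_two]
    · rw [hW, Set.indicator_of_notMem hξ, Set.indicator_of_notMem hξ, zero_mul,
        ENNReal.zero_rpow_of_pos two_pos]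
  rw [one_mul, h2] at h1
  have h3 := ENNReal.rpow_le_rpow h1 (by norm_num : (0 : ℝ) ≤ 2)
  rwa [← ENNReal.rpow_mul, show (1 / 2 : ℝ) * 2 = 1 by norm_num, ENNReal.rpow_one,
    ENNReal.rpow_two] at h3

/-- `floor_cert`: a state read in `Ain` carries energy `≥ E_n` at frequencies `|ξ| ≥ λ_n` (its input
amplitude exceeds `1`, so `|⟨v, ψ_n⟩|² > E_n`). The junk hypothesis is not needed. [folklore] -/
theorem floor_cert (n : ℕ) (v : L2C) (hv : read 𝒟 S n v ∈ Ain P) :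
    ENNReal.ofReal (S.Emin n) ≤ highFreqEnergy (S.lam n) v := by
  rw [P.lam_eq]
  have hE := sqrt_Emin_pos S n
  have h1 : 1 < (coef 𝒟 n v).re / Real.sqrt (S.Emin n) := one_lt_of_mem_Ain hv
  have h2 : Real.sqrt (S.Emin n) < ‖coef 𝒟 n v‖ := by
    rw [lt_div_iff₀ hE, one_mul] at h1
    exact h1.trans_le ((le_abs_self _).trans (Complex.abs_re_le_norm _))
  have h3 : S.Emin n ≤ ‖coef 𝒟 n v‖ ^ 2 := by
    rw [← Real.sq_sqrt (S.Emin_pos n).le]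
    exact pow_le_pow_left₀ hE.le h2.le 2
  calc ENNReal.ofReal (S.Emin n) ≤ ENNReal.ofReal (‖coef 𝒟 n v‖ ^ 2) := ENNReal.ofReal_le_ofReal h3
    _ = ‖coef 𝒟 n v‖ₑ ^ 2 := by rw [ENNReal.ofReal_pow (norm_nonneg _), ofReal_norm]
    _ ≤ highFreqEnergy ((2 : ℝ) ^ n) v := enorm_coef_sq_le_highFreqEnergy n v

end Design

end BlockDesign

end Summit.NavierStokesRegularity.FluidComputer

end
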